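import Literature.NumberTheory.ComplexMultiplication.CMTypeRankPairFlipTransfer
import Literature.NumberTheory.ComplexMultiplication.CMTypeCount
import Literature.NumberTheory.ComplexMultiplication.CMFieldNormalClosure
import Literature.NumberTheory.ComplexMultiplication.CMFieldConjSquareQuadraticSubfields
import HarnessLib

/-!
# Dodson's Reflex Degree Theorem: `[K′ : ℚ] = 2ᵛ · (G₀ : S₀)`, and the imprimitivity sequence
# `1 → Gal(Kᶜ/K₀ᶜ) = (ℤ/2)ᵛ → Gal(Kᶜ/ℚ) → Gal(K₀ᶜ/ℚ) → 1` of a CM field (Dodson 1984, §1)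

B. Dodson, *The structure of Galois groups of CM-fields*, Trans. AMS **283** (1984) 1–32 [Dodson1984] (held text
`paper:doi-10-2307-1999987`, pp. 2–7 read 2026-08-21), §1 "The reflex degree theorem":

* **§1.1 Proposition** (p. 2): "The Galois group of a CM-field of degree `2n` is given by an exact sequence
  `0 → (ℤ₂)ᵛ → Gal(Kᶜ/ℚ) → Gal(K₀ᶜ/ℚ) → 1`, `1 ≤ v ≤ n`, where `(ℤ₂)ᵛ` is identified with the subgroup
  `Gal(Kᶜ/K₀ᶜ)` of `Gal(Kᶜ/ℚ)`" (`K₀` the maximal totally real subfield of `K`, `K₀ᶜ`, `Kᶜ` Galois closures; proof,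
  p. 3: "every automorphism `e` of `Kᶜ` fixing `K₀ᶜ` is determined by the images `(-δⱼ)^{1/2} ↦ eⱼ(-δⱼ)^{1/2}`, with
  `eⱼ = ±1` … the automorphism `ρ` … has image `(1, …, 1)`, so `v ≥ 1`").
* **§1.1 Imprimitivity Theorem (2)** (p. 3): "`(ℤ₂)ᵛ = Gal(Kᶜ/K₀ᶜ)` is identified with the group of permutations
  preserving the sets of imprimitivity" (the `n` pairs `{φ, φ̄}` of complex-conjugate embeddings) "and is acted
  upon by `G₀` by permutation of coordinates under an inclusion `i : (ℤ₂)ᵛ → (ℤ₂)ⁿ`".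
* **§1.3 The Reflex Degree Theorem** (p. 5): "Let `K/ℚ` be a CM-field with maximal totally real subfield `K₀`.
  Let `0 → (ℤ₂)ᵛ → G → G₀ → 1` be the imprimitivity sequence of `G = Gal(Kᶜ/ℚ)` … Let `(K, Φ)` be a CM-type and
  `K′ = K′(Φ)` the reflex field of `(K, Φ)`.  Then … `[K′ : ℚ] = 2ᵛ (G₀ : S₀)`, where `2ᵛ = [Kᶜ : K₀ᶜ]`, and
  `(G₀ : S₀)` is the index in `G₀` of the splitting subgroup `S₀ = S₀(f)`"; proof: "`[K′ : ℚ] = (G : H′(Φ))` with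
  `H′(Φ)` the stabilizer of `Φ` … `Proj_{G₀}` gives an isomorphism of `H′(Φ)` onto `S₀`"; **Remark**: "`[K′ : ℚ]` is
  also the order of the orbit of `Φ` under the `G`-action" (the tree's `finrank_reflexField_eq_card_orbit`).
* **§2.1.2 Corollary of the Reflex Degree Theorem** (p. 7): `K` has a CM type with `[K′ : ℚ] = [Kᶜ : K₀ᶜ] = 2ᵛ`
  (if and) only if "`Gal(Kᶜ/K′) ≅ Gal(K₀ᶜ/ℚ)` gives a splitting of the imprimitivity sequence of `Gal(Kᶜ/ℚ)`".

The mechanism is one line: an element of `Gal(Kᶜ/K₀ᶜ)` permutes each pair `{φ, φ̄}`; if it stabilises a CM type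
(which contains exactly one of `φ, φ̄`) it fixes every embedding, hence is trivial — `Gal(Kᶜ/K′) ∩ Gal(Kᶜ/K₀ᶜ) = 1`,
i.e. **`Kᶜ = K′ · K₀ᶜ` for every CM type** — and `|G · Φ| = (G : H′) = |(ℤ₂)ᵛ| · (G : H′ · (ℤ₂)ᵛ)`.

## Contents (everything PROVED; theorems only — no definition, no named fact, net debt 0)

Part I, GROUP LEVEL — the tree's carrier (W) of `CMTypeRank.lean` / `CMTypeDictionaryGroupLevel.lean`: a group
`G` acting on `E` (the embeddings), `ρ ∈ G` and `Φ ⊆ E` with `IsCMTypeWith ρ Φ`.  Dodson's `(ℤ₂)ᵛ` is the PAIR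
KERNEL: a subgroup `V ≤ G` with `g ∈ V ↔ ∀ x, g • x = x ∨ g • x = ρ • x` (the "pair-preserving" elements of
`CMTypeRankPairFlipTransfer.lean`); concretely `V = ⨅ₓ Stab_G {x, ρx}` (`IsCMTypeWith.mem_iInf_stabilizer_pair_iff`),
and every statement is made for any subgroup `V` so characterised (hypothesis `hV`), so that Part II can take
`V = Gal(L/K₀ᶜ)` verbatim.
* `rho_mem_of_pairKernel`, `IsCMTypeWith.pairKernel_normal`, `….smul_smul_eq_of_mem_pairKernel`,
  `….mul_self_eq_one_of_mem_pairKernel`, `….mul_comm_of_mem_pairKernel`, `….isPGroup_two_pairKernel`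
  (§1.1 Proposition: `V` is a normal elementary abelian `2`-subgroup containing `ρ`; faithful action for `g² = 1`);
  `….setOf_conj_smul_eq_rho_smul` (Imprimitivity Theorem (2): conjugation by `g` permutes the coordinates = the
  flipped pairs); `….card_pairKernel_le_two_pow`, `….exists_card_pairKernel_eq_two_pow` (`|V| = 2ᵛ`,
  `1 ≤ v ≤ |E|/2`).
* **`IsCMTypeWith.smul_eq_self_of_mem_stabilizer_of_mem_pairKernel`**, **`….stabilizer_inf_pairKernel_eq_bot`**
  (`H′(Φ) ∩ V = 1`), `….injOn_quotientMk_stabilizer` ("`Proj` gives an isomorphism of `H′(Φ)` onto `S₀`");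
* **`IsCMTypeWith.index_stabilizer_eq_card_pairKernel_mul`** / **`….card_orbit_eq_card_pairKernel_mul`** — the
  Reflex Degree Theorem at group level: `|G · Φ| = (G : H′) = |V| · (G : H′ ⊔ V)`; `….card_pairKernel_dvd_card_orbit`;
  `….card_orbit_eq_card_pairKernel_iff`, `….isComplement'_stabilizer_pairKernel_iff` (§2.1.2 Corollary: the orbit
  has exactly `|V|` elements iff `H′(Φ)` is a complement of `V`).

Part II, NUMBER FIELDS — the tree's carrier (W_L): `K` a CM number field, `L` a CM number field Galois over `ℚ`
(typically a normal closure of `K`, `IsNormalClosure ℚ K L`, which is CM by `isCMField_of_isNormalClosure`),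
`G = Gal(L/ℚ) = L ≃ₐ[ℚ] L` acting on `E = Hom_ℚ(K, L)` by the scoped `algEquivCompAction`, `ρ = conjGal`; Dodson's
`K₀ᶜ` is `normalClosure ℚ K⁺ L` with `K⁺ = NumberField.maximalRealSubfield K`, his `Kᶜ` is `normalClosure ℚ K L`
(`= ⊤` for a normal closure), and `K′(Φ)` is the tree's `reflexField ℚ L Ψ` of a (W_L)-type `Ψ`
(`IsCMTypeWith conjGal Ψ`, e.g. `Ψ = algValuedIn ι Φ` for `Φ : CMType K`, `isCMTypeWith_conjGal_algValuedIn`).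
* `forall_apply_eq_iff_smul_eq_or` — `g ∘ φ` agrees with `φ` on `K⁺` iff `g ∘ φ ∈ {φ, φ̄}` (the two extensions of
  a real embedding; proof p. 3);
* **`mem_fixingSubgroup_normalClosure_maximalRealSubfield_iff`** — Imprimitivity Theorem (2):
  `Gal(L/K₀ᶜ) = {g | ∀ φ, g ∘ φ ∈ {φ, φ̄}}` (`= ⨅_φ Stab{φ, φ̄}`, `fixingSubgroup_normalClosure_maximalRealSubfield_eq`);
  `mem_fixingSubgroup_normalClosure_iff` (`Gal(L/Kᶜ)` = the kernel of the action);
* §1.1 Proposition on fields: `conjGal_mem_fixingSubgroup_normalClosure_maximalRealSubfield` (`ρ ∈ Gal(L/K₀ᶜ)`,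
  i.e. `K₀ᶜ` is totally real inside `L`), `mul_self_eq_one_of_mem_fixingSubgroup_normalClosure_maximalRealSubfield`,
  `mul_comm_of_mem_fixingSubgroup_normalClosure_maximalRealSubfield`,
  **`exists_finrank_normalClosure_maximalRealSubfield_eq_two_pow`** (`[Kᶜ : K₀ᶜ] = 2ᵛ`, `1 ≤ v ≤ [K : ℚ]/2`);
* **`reflexField_sup_normalClosure_maximalRealSubfield_eq_normalClosure`** (`K′ · K₀ᶜ = Kᶜ` in any Galois CM `L`)
  and **`reflexField_sup_normalClosure_maximalRealSubfield_eq_top`** (`= L` for a normal closure) — the Reflex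
  Degree Theorem in field form; **`finrank_reflexField_eq_finrank_mul_finrank_inf`** —
  `[K′ : ℚ] = [Kᶜ : K₀ᶜ] · [K′ ∩ K₀ᶜ : ℚ]` (Dodson's `2ᵛ (G₀ : S₀)`: `S₀ =` the image of `Gal(Kᶜ/K′)` in
  `G₀ = Gal(K₀ᶜ/ℚ)` is `Gal(K₀ᶜ/K′ ∩ K₀ᶜ)`); **`finrank_normalClosure_maximalRealSubfield_dvd_finrank_reflexField`**
  (`2ᵛ ∣ [K′ : ℚ]`), `finrank_normalClosure_maximalRealSubfield_le_finrank_reflexField`;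
  `injOn_quotientMk_stabilizer_fixingSubgroup` (`H′(Φ) ≅ S₀`);
* §2.1.2 Corollary: **`finrank_reflexField_eq_iff_inf_eq_bot`** (`[K′ : ℚ] = 2ᵛ ⟺ K′ ∩ K₀ᶜ = ℚ`) and
  **`finrank_reflexField_eq_iff_isComplement'`** (`⟺ Gal(L/K′)` is a complement of `Gal(L/K₀ᶜ)`: the
  imprimitivity sequence splits through `Gal(L/K′) ≅ Gal(K₀ᶜ/ℚ)`).

NOT typed here: Dodson's coordinates `Φ = Φᶠ`, `f ∈ (ℤ₂)ⁿ` and the twisted action of §1.2, the cocycle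
`j ∘ s ∈ Z¹(G₀, (ℤ₂)ⁿ/(ℤ₂)ᵛ)` of the Imprimitivity Theorem (3) and the `ρ`-structures of §2 (the "if" direction of
the §2.1.2 Corollary is stated there in terms of that cocycle class, not of an arbitrary splitting).

## References

* [Dodson1984] B. Dodson, *The structure of Galois groups of CM-fields*, Trans. AMS 283 (1984), §1.1
  Proposition and Imprimitivity Theorem, §1.3 Reflex Degree Theorem and Remark, §2.1.1 Remark 1, §2.1.2 Corollary.
* [Shimura1998] G. Shimura, *Abelian Varieties with Complex Multiplication and Modular Functions* (1998), §8.3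
  Prop. 28 (the reflex field is the fixed field of `H* = Stab(Φ)`), §18.2 Lemma (i) (`ρ` central) — through the
  tree's `ReflexType.lean`, `EmbeddingActionFaithful.lean`, `CMTypeDictionaryGroupLevel.lean`.
-/

set_option autoImplicit false

open scoped Pointwise

namespace Literature.NumberTheory.ComplexMultiplication

/-! ## Part I — group level: the pair kernel `(ℤ₂)ᵛ` and the stabiliser of a CM type -/

section GroupLevel

variable {G : Type*} [Group G] {E : Type*} [MulAction G E] {ρ : G} {Φ : Set E}

/-- `ρ` itself preserves every pair `{x, ρx}`: `ρ ∈ (ℤ₂)ᵛ` ("the automorphism `ρ` … has image `(1, …, 1)`, so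
`v ≥ 1`"). [cite: Dodson1984, §1.1 Proposition (proof)] -/
theorem rho_mem_of_pairKernel {V : Subgroup G} (hV : ∀ g : G, g ∈ V ↔ ∀ x : E, g • x = x ∨ g • x = ρ • x) :
    ρ ∈ V :=
  (hV ρ).2 fun _ => Or.inr rfl

namespace IsCMTypeWith

/-- **The pair kernel, concretely**: `g` lies in every stabiliser `Stab_G {x, ρx}` of a pair of conjugate embeddings
iff `g` maps each `x` to `x` or to `ρx` — "the group of permutations preserving the sets of imprimitivity".
[cite: Dodson1984, §1.1 Imprimitivity Theorem (2)] -/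
theorem mem_iInf_stabilizer_pair_iff (h : IsCMTypeWith ρ Φ) (g : G) :
    g ∈ ⨅ x : E, MulAction.stabilizer G ({x, ρ • x} : Set E) ↔ ∀ x : E, g • x = x ∨ g • x = ρ • x := by
  rw [Subgroup.mem_iInf]
  refine forall_congr' fun x => ?_
  rw [MulAction.mem_stabilizer_iff, Set.smul_set_insert, Set.smul_set_singleton]
  constructor
  · intro hx
    have hmem : g • x ∈ ({x, ρ • x} : Set E) := by
      rw [← hx]
      exact Set.mem_insert _ _
    simpa only [Set.mem_insert_iff, Set.mem_singleton_iff] using hmem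
  · rintro (hx | hx)
    · rw [h.comm, hx]
    · rw [h.comm, hx, h.invol, Set.pair_comm]

/-- **`(ℤ₂)ᵛ` is normal in `G`** (it is the kernel of the action on the pairs). [cite: Dodson1984, §1.1 Proposition] -/
theorem pairKernel_normal (h : IsCMTypeWith ρ Φ) {V : Subgroup G}
    (hV : ∀ g : G, g ∈ V ↔ ∀ x : E, g • x = x ∨ g • x = ρ • x) : V.Normal := by
  refine ⟨fun g hg c => (hV _).2 fun x => ?_⟩
  rcases (hV g).1 hg (c⁻¹ • x) with hx | hx
  · left
    rw [mul_smul, mul_smul, hx, smul_inv_smul]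
  · right
    rw [mul_smul, mul_smul, hx, h.comm, smul_inv_smul]

/-- The square of an element of `(ℤ₂)ᵛ` acts trivially ("`eⱼ = ±1`"). [cite: Dodson1984, §1.1 Proposition (proof)] -/
theorem smul_smul_eq_of_mem_pairKernel (h : IsCMTypeWith ρ Φ) {V : Subgroup G}
    (hV : ∀ g : G, g ∈ V ↔ ∀ x : E, g • x = x ∨ g • x = ρ • x) {g : G} (hg : g ∈ V) (x : E) :
    g • g • x = x :=
  smul_smul_eq_of_pairPreserving h ((hV g).1 hg) x

/-- **`(ℤ₂)ᵛ` has exponent `2`**: for a faithful action (`G = Gal(Kᶜ/ℚ)` IS a permutation group of the embeddings)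
every element of the pair kernel squares to `1`. [cite: Dodson1984, §1.1 Proposition] -/
theorem mul_self_eq_one_of_mem_pairKernel [FaithfulSMul G E] (h : IsCMTypeWith ρ Φ) {V : Subgroup G}
    (hV : ∀ g : G, g ∈ V ↔ ∀ x : E, g • x = x ∨ g • x = ρ • x) {g : G} (hg : g ∈ V) : g * g = 1 :=
  eq_of_smul_eq_smul (α := E) fun x => by
    rw [mul_smul, one_smul, h.smul_smul_eq_of_mem_pairKernel hV hg x]

/-- **`(ℤ₂)ᵛ` is commutative** (a group of exponent `2`). [cite: Dodson1984, §1.1 Proposition] -/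
theorem mul_comm_of_mem_pairKernel [FaithfulSMul G E] (h : IsCMTypeWith ρ Φ) {V : Subgroup G}
    (hV : ∀ g : G, g ∈ V ↔ ∀ x : E, g • x = x ∨ g • x = ρ • x) {a b : G} (ha : a ∈ V) (hb : b ∈ V) :
    a * b = b * a := by
  have hab : a * b = (a * b)⁻¹ := mul_eq_one_iff_eq_inv.1 (h.mul_self_eq_one_of_mem_pairKernel hV (V.mul_mem ha hb))
  have ha' : a = a⁻¹ := mul_eq_one_iff_eq_inv.1 (h.mul_self_eq_one_of_mem_pairKernel hV ha)
  have hb' : b = b⁻¹ := mul_eq_one_iff_eq_inv.1 (h.mul_self_eq_one_of_mem_pairKernel hV hb)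
  rw [mul_inv_rev, ← ha', ← hb'] at hab
  exact hab

/-- **`(ℤ₂)ᵛ` is a `2`-group** (for a faithful action). [cite: Dodson1984, §1.1 Proposition] -/
theorem isPGroup_two_pairKernel [FaithfulSMul G E] (h : IsCMTypeWith ρ Φ) {V : Subgroup G}
    (hV : ∀ g : G, g ∈ V ↔ ∀ x : E, g • x = x ∨ g • x = ρ • x) : IsPGroup 2 V := by
  intro g
  refine ⟨1, Subtype.ext ?_⟩
  rw [pow_one, Subgroup.coe_pow, Subgroup.coe_one, pow_two]
  exact h.mul_self_eq_one_of_mem_pairKernel hV g.2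

/-- **`G₀` acts on `(ℤ₂)ᵛ ⊆ (ℤ₂)ⁿ` by permuting coordinates**: the set of points flipped by the conjugate
`c g c⁻¹` is the `c`-translate of the set flipped by `g`. [cite: Dodson1984, §1.1 Imprimitivity Theorem (2)] -/
theorem setOf_conj_smul_eq_rho_smul (h : IsCMTypeWith ρ Φ) (g c : G) :
    {x : E | (c * g * c⁻¹) • x = ρ • x} = c • {x : E | g • x = ρ • x} := by
  ext x
  rw [Set.mem_smul_set_iff_inv_smul_mem, Set.mem_setOf_eq, Set.mem_setOf_eq, mul_smul, mul_smul]
  constructor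
  · intro hx
    have hx' : g • c⁻¹ • x = c⁻¹ • ρ • x := by
      have := congrArg (c⁻¹ • ·) hx
      simpa only [inv_smul_smul] using this
    rw [hx', h.comm]
  · intro hx
    rw [hx, h.comm, smul_inv_smul]

/-- **An element of `(ℤ₂)ᵛ` stabilising a CM type acts trivially** on the embeddings: it maps each `x` to `x` or
`ρx`, and `ρx` would change the membership of `x` in the type. [cite: Dodson1984, §1.3 Reflex Degree Theorem (proof)] -/
theorem smul_eq_self_of_mem_stabilizer_of_mem_pairKernel (h : IsCMTypeWith ρ Φ) {V : Subgroup G}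
    (hV : ∀ g : G, g ∈ V ↔ ∀ x : E, g • x = x ∨ g • x = ρ • x) {g : G}
    (hg : g ∈ MulAction.stabilizer G Φ) (hgV : g ∈ V) (x : E) : g • x = x := by
  rw [MulAction.mem_stabilizer_iff] at hg
  rcases (hV g).1 hgV x with hx | hx
  · exact hx
  · exfalso
    have key : g • x ∈ Φ ↔ x ∈ Φ := by
      rw [← Set.smul_mem_smul_set_iff (a := g) (x := x) (s := Φ), hg]
    rw [hx, h.rho_smul_mem_iff] at key
    exact not_iff_self key

/-- **`H′(Φ) ∩ (ℤ₂)ᵛ = 1`** for a faithful action: the stabiliser of a CM type meets the pair kernel trivially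
("`Proj_{G₀}` gives an isomorphism of `H′(Φ)` onto `S₀`"). [cite: Dodson1984, §1.3 Reflex Degree Theorem (proof)] -/
theorem stabilizer_inf_pairKernel_eq_bot [FaithfulSMul G E] (h : IsCMTypeWith ρ Φ) {V : Subgroup G}
    (hV : ∀ g : G, g ∈ V ↔ ∀ x : E, g • x = x ∨ g • x = ρ • x) : MulAction.stabilizer G Φ ⊓ V = ⊥ := by
  rw [eq_bot_iff]
  intro g hg
  rw [Subgroup.mem_inf] at hg
  rw [Subgroup.mem_bot]
  exact eq_of_smul_eq_smul (α := E) fun x => by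
    rw [one_smul, h.smul_eq_self_of_mem_stabilizer_of_mem_pairKernel hV hg.1 hg.2 x]

/-- **`H′(Φ) ≅ S₀`**: the projection `G → G/(ℤ₂)ᵛ = G₀` is injective on the stabiliser of a CM type.
[cite: Dodson1984, §1.3 Reflex Degree Theorem (proof)] -/
theorem injOn_quotientMk_stabilizer [FaithfulSMul G E] (h : IsCMTypeWith ρ Φ) {V : Subgroup G}
    (hV : ∀ g : G, g ∈ V ↔ ∀ x : E, g • x = x ∨ g • x = ρ • x) :
    Set.InjOn (QuotientGroup.mk : G → G ⧸ V) (MulAction.stabilizer G Φ) := by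
  intro a ha b hb hab
  have hmem : a⁻¹ * b ∈ MulAction.stabilizer G Φ ⊓ V :=
    Subgroup.mem_inf.2 ⟨(MulAction.stabilizer G Φ).mul_mem ((MulAction.stabilizer G Φ).inv_mem ha) hb,
      QuotientGroup.eq.1 hab⟩
  rw [h.stabilizer_inf_pairKernel_eq_bot hV, Subgroup.mem_bot] at hmem
  exact inv_mul_eq_one.1 hmem

/-- **The Reflex Degree Theorem, group level, index form**: `(G : H′(Φ)) = |(ℤ₂)ᵛ| · (G : H′(Φ) · (ℤ₂)ᵛ)` — Dodson's
`[K′ : ℚ] = 2ᵛ (G₀ : S₀)` with `(G₀ : S₀) = (G : H′ (ℤ₂)ᵛ)` (`G` finite, faithful action).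
[cite: Dodson1984, §1.3 Reflex Degree Theorem] -/
theorem index_stabilizer_eq_card_pairKernel_mul [FaithfulSMul G E] [Finite G] (h : IsCMTypeWith ρ Φ)
    {V : Subgroup G} (hV : ∀ g : G, g ∈ V ↔ ∀ x : E, g • x = x ∨ g • x = ρ • x) :
    (MulAction.stabilizer G Φ).index = Nat.card V * (MulAction.stabilizer G Φ ⊔ V).index := by
  haveI : V.Normal := h.pairKernel_normal hV
  set S := MulAction.stabilizer G Φ with hS_def
  have hbot : S ⊓ V = ⊥ := h.stabilizer_inf_pairKernel_eq_bot hV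
  -- second isomorphism theorem in index form: `[S ⊔ V : V]`-type identity
  have h2 : V.relIndex (S ⊔ V) * (S ⊔ V).index = V.index := Subgroup.relIndex_mul_index le_sup_right
  rw [Subgroup.relIndex_sup_right] at h2
  have h3 : V.relIndex S = Nat.card S := by
    rw [← Subgroup.inf_relIndex_right, inf_comm, hbot, Subgroup.relIndex_bot_left]
  rw [h3] at h2
  have h4 : Nat.card S * S.index = Nat.card G := Subgroup.card_mul_index S
  have h5 : Nat.card V * V.index = Nat.card G := Subgroup.card_mul_index V
  have hpos : 0 < Nat.card S := Nat.card_pos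
  have key : Nat.card S * S.index = Nat.card S * (Nat.card V * (S ⊔ V).index) := by
    rw [h4, ← h5, ← h2]
    ring
  exact Nat.eq_of_mul_eq_mul_left hpos key

/-- **The Reflex Degree Theorem, group level, orbit form**: the orbit of a CM type has
`|(ℤ₂)ᵛ| · (G : H′(Φ) · (ℤ₂)ᵛ)` elements ("`[K′ : ℚ]` is also the order of the orbit of `Φ` under the `G`-action").
[cite: Dodson1984, §1.3 Reflex Degree Theorem and Remark] -/
theorem card_orbit_eq_card_pairKernel_mul [FaithfulSMul G E] [Finite G] (h : IsCMTypeWith ρ Φ)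
    {V : Subgroup G} (hV : ∀ g : G, g ∈ V ↔ ∀ x : E, g • x = x ∨ g • x = ρ • x) :
    Nat.card (MulAction.orbit G Φ) = Nat.card V * (MulAction.stabilizer G Φ ⊔ V).index := by
  rw [Nat.card_coe_set_eq, ← MulAction.index_stabilizer]
  exact h.index_stabilizer_eq_card_pairKernel_mul hV

/-- **`2ᵛ` divides `[K′ : ℚ]`**, group level: `|(ℤ₂)ᵛ|` divides the size of the orbit of every CM type.
[cite: Dodson1984, §1.3 Reflex Degree Theorem] -/
theorem card_pairKernel_dvd_card_orbit [FaithfulSMul G E] [Finite G] (h : IsCMTypeWith ρ Φ)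
    {V : Subgroup G} (hV : ∀ g : G, g ∈ V ↔ ∀ x : E, g • x = x ∨ g • x = ρ • x) :
    Nat.card V ∣ Nat.card (MulAction.orbit G Φ) :=
  Dvd.intro _ (h.card_orbit_eq_card_pairKernel_mul hV).symm

/-- **§2.1.2 Corollary, group level**: the orbit of `Φ` has exactly `|(ℤ₂)ᵛ|` elements iff `H′(Φ) · (ℤ₂)ᵛ = G`,
i.e. iff the splitting subgroup `S₀` is all of `G₀`. [cite: Dodson1984, §2.1.2 Corollary] -/
theorem card_orbit_eq_card_pairKernel_iff [FaithfulSMul G E] [Finite G] (h : IsCMTypeWith ρ Φ)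
    {V : Subgroup G} (hV : ∀ g : G, g ∈ V ↔ ∀ x : E, g • x = x ∨ g • x = ρ • x) :
    Nat.card (MulAction.orbit G Φ) = Nat.card V ↔ MulAction.stabilizer G Φ ⊔ V = ⊤ := by
  rw [h.card_orbit_eq_card_pairKernel_mul hV, ← Subgroup.index_eq_one]
  have hV0 : 0 < Nat.card V := Nat.card_pos
  constructor
  · intro heq
    apply Nat.eq_of_mul_eq_mul_left hV0
    rw [mul_one]
    exact heq
  · intro h1
    rw [h1, mul_one]

/-- **§2.1.2 Corollary, group level, complement form**: `H′(Φ)` is a complement of `(ℤ₂)ᵛ` in `G` ("gives a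
splitting of the imprimitivity sequence") iff the orbit of `Φ` has exactly `|(ℤ₂)ᵛ|` elements.
[cite: Dodson1984, §2.1.2 Corollary] -/
theorem isComplement'_stabilizer_pairKernel_iff [FaithfulSMul G E] [Finite G] (h : IsCMTypeWith ρ Φ)
    {V : Subgroup G} (hV : ∀ g : G, g ∈ V ↔ ∀ x : E, g • x = x ∨ g • x = ρ • x) :
    (MulAction.stabilizer G Φ).IsComplement' V ↔ Nat.card (MulAction.orbit G Φ) = Nat.card V := by
  rw [Subgroup.isComplement'_iff_card_mul_and_disjoint, disjoint_iff, Nat.card_coe_set_eq,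
    ← MulAction.index_stabilizer]
  have hbot : MulAction.stabilizer G Φ ⊓ V = ⊥ := h.stabilizer_inf_pairKernel_eq_bot hV
  have hL : Nat.card (MulAction.stabilizer G Φ) * (MulAction.stabilizer G Φ).index = Nat.card G :=
    Subgroup.card_mul_index _
  have hpos : 0 < Nat.card (MulAction.stabilizer G Φ) := Nat.card_pos
  constructor
  · rintro ⟨hcard, -⟩
    apply Nat.eq_of_mul_eq_mul_left hpos
    rw [hL, hcard]
  · intro hidx
    refine ⟨?_, hbot⟩
    rw [← hidx, hL]

section Card

variable [Fintype E] [DecidableEq E] [DecidablePred (· ∈ Φ)]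

/-- The coordinates of an element of `(ℤ₂)ᵛ ⊆ (ℤ₂)ⁿ`: the set of points OF THE TYPE that it flips determines it
(faithful action). [cite: Dodson1984, §1.1 Proposition (proof)] -/
private theorem flipFinset_injective [FaithfulSMul G E] (h : IsCMTypeWith ρ Φ) {V : Subgroup G}
    (hV : ∀ g : G, g ∈ V ↔ ∀ x : E, g • x = x ∨ g • x = ρ • x) :
    Function.Injective fun g : V => Finset.univ.filter fun x : Φ => (g : G) • (x : E) = ρ • (x : E) := by
  intro a b hab
  apply Subtype.ext
  have hΦ : ∀ x ∈ Φ, (a : G) • x = (b : G) • x := by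
    intro x hx
    have key := congrArg (fun s : Finset Φ => (⟨x, hx⟩ : Φ) ∈ s) hab
    simp only [Finset.mem_filter, Finset.mem_univ, true_and, eq_iff_iff] at key
    have hρx : ρ • x ≠ x := h.rho_smul_ne x
    rcases (hV a).1 a.2 x with ha | ha <;> rcases (hV b).1 b.2 x with hb | hb
    · rw [ha, hb]
    · exact absurd ((key.2 hb).symm.trans ha) hρx
    · exact absurd ((key.1 ha).symm.trans hb) hρx
    · rw [ha, hb]
  refine eq_of_smul_eq_smul (α := E) fun x => ?_
  by_cases hx : x ∈ Φ
  · exact hΦ x hx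
  · have hρx : ρ • x ∈ Φ := (h.rho_smul_mem_iff x).2 hx
    calc (a : G) • x = (a : G) • ρ • ρ • x := by rw [h.invol]
      _ = ρ • (a : G) • ρ • x := h.comm _ _
      _ = ρ • (b : G) • ρ • x := by rw [hΦ (ρ • x) hρx]
      _ = (b : G) • ρ • ρ • x := (h.comm _ _).symm
      _ = (b : G) • x := by rw [h.invol]

end Card

/-- **`|(ℤ₂)ᵛ| ≤ 2ⁿ`**, `n = |E|/2` the number of pairs: an element of the pair kernel is determined by the set of
pairs it flips (faithful action; "`Gal(Kᶜ/K₀ᶜ)` may be identified with the image in `(ℤ₂)ⁿ` of the map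
`e ↦ (e₁, …, eₙ)`"). [cite: Dodson1984, §1.1 Proposition (proof)] -/
theorem card_pairKernel_le_two_pow [FaithfulSMul G E] [Finite E] (h : IsCMTypeWith ρ Φ) {V : Subgroup G}
    (hV : ∀ g : G, g ∈ V ↔ ∀ x : E, g • x = x ∨ g • x = ρ • x) :
    Nat.card V ≤ 2 ^ (Nat.card E / 2) := by
  classical
  haveI : Fintype E := Fintype.ofFinite E
  have hinj := h.flipFinset_injective hV
  have hle := Nat.card_le_card_of_injective _ hinj
  rw [Nat.card_eq_fintype_card (α := Finset Φ), Fintype.card_finset, ← Nat.card_eq_fintype_card,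
    Nat.card_coe_set_eq] at hle
  have hhalf : Φ.ncard = Nat.card E / 2 := by
    have := two_mul_ncard_eq_card_of_cm (c := ρ) h.mem_iff
    omega
  rwa [hhalf] at hle

/-- **§1.1 Proposition: `|(ℤ₂)ᵛ| = 2ᵛ` with `1 ≤ v ≤ n`** (`n = |E|/2`; faithful action on a non-empty finite set of
embeddings: `v ≥ 1` because `ρ ∈ (ℤ₂)ᵛ` is not trivial, `v ≤ n` by the coordinates).
[cite: Dodson1984, §1.1 Proposition] -/
theorem exists_card_pairKernel_eq_two_pow [FaithfulSMul G E] [Finite E] [Nonempty E] (h : IsCMTypeWith ρ Φ)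
    {V : Subgroup G} (hV : ∀ g : G, g ∈ V ↔ ∀ x : E, g • x = x ∨ g • x = ρ • x) :
    ∃ v : ℕ, 1 ≤ v ∧ v ≤ Nat.card E / 2 ∧ Nat.card V = 2 ^ v := by
  classical
  haveI : Fintype E := Fintype.ofFinite E
  haveI : Finite V := Finite.of_injective _ (h.flipFinset_injective hV)
  obtain ⟨v, hv⟩ := (h.isPGroup_two_pairKernel hV).exists_card_eq
  have hle := h.card_pairKernel_le_two_pow hV
  rw [hv] at hle
  refine ⟨v, ?_, (Nat.pow_le_pow_iff_right (by norm_num)).1 hle, hv⟩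
  -- `ρ ∈ V` is a non-trivial element
  obtain ⟨x⟩ := ‹Nonempty E›
  have hρ1 : ρ ≠ 1 := fun hρ => h.rho_smul_ne x (by rw [hρ, one_smul])
  have hnt : Nontrivial V := ⟨⟨⟨ρ, rho_mem_of_pairKernel hV⟩, 1, fun hc => hρ1 (congrArg Subtype.val hc)⟩⟩
  have h1 : 1 < Nat.card V := Finite.one_lt_card_iff_nontrivial.2 hnt
  rw [hv] at h1
  by_contra hv0
  push Not at hv0
  interval_cases v
  simp at h1

end IsCMTypeWith

end GroupLevel

/-! ## Part II — number fields: `Gal(L/K₀ᶜ)` is the pair kernel; the Reflex Degree Theorem on fields -/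

section NumberField

open NumberField IntermediateField
open Literature.AlgebraicGeometry.Motives (CMType)

variable {K : Type} [Field K] [NumberField K] [IsCMField K]
variable {L : Type} [Field L] [NumberField L] [IsCMField L]

/-- **The two extensions of a real embedding.**  For `g ∈ Gal(L/ℚ)` and an embedding `φ : K → L` of the CM field
`K`: `g ∘ φ` agrees with `φ` on the maximal totally real subfield `K⁺` iff `g ∘ φ = φ` or `g ∘ φ = φ̄ = ρ ∘ φ`
("`K = K₀((-δ)^{1/2})` … `(-δⱼ)^{1/2} ↦ eⱼ(-δⱼ)^{1/2}` with `eⱼ = ±1`"; here: every `φ(x)`, `x ∈ K`, is a root of a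
quadratic over `φ(K⁺)` whose other root is `φ(x̄)`, and `K` is not the union of two proper additive subgroups).
[cite: Dodson1984, §1.1 Proposition (proof)] -/
theorem forall_apply_eq_iff_smul_eq_or (g : L ≃ₐ[ℚ] L) (φ : K →ₐ[ℚ] L) :
    (∀ x : K, x ∈ maximalRealSubfield K → g (φ x) = φ x) ↔
      g • φ = φ ∨ g • φ = (conjGal : L ≃ₐ[ℚ] L) • φ := by
  constructor
  · intro hfix
    -- every `g(φ x)` is `φ x` or `φ x̄`
    have hroot : ∀ x : K, g (φ x) = φ x ∨ g (φ x) = φ (IsCMField.complexConj K x) := by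
      intro x
      set xb := IsCMField.complexConj K x with hxb
      have hs : x + xb ∈ maximalRealSubfield K := by
        rw [← IsCMField.complexConj_eq_self_iff K, map_add, hxb, IsCMField.complexConj_apply_apply, add_comm]
      have hp : x * xb ∈ maximalRealSubfield K := by
        rw [← IsCMField.complexConj_eq_self_iff K, map_mul, hxb, IsCMField.complexConj_apply_apply, mul_comm]
      have e1 : g (φ (x + xb)) = φ (x + xb) := hfix _ hs
      have e2 : g (φ (x * xb)) = φ (x * xb) := hfix _ hp
      have key : (g (φ x) - φ x) * (g (φ x) - φ xb) = 0 := by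
        have expand : (g (φ x) - φ x) * (g (φ x) - φ xb) =
            g (φ x) * g (φ x) - φ (x + xb) * g (φ x) + φ (x * xb) := by
          rw [map_add, map_mul]
          ring
        rw [expand, ← e1, ← e2, ← map_mul, ← map_mul, ← map_mul, ← map_mul, ← map_sub, ← map_sub, ← map_add,
          ← map_add]
        have hzero : x * x - (x + xb) * x + x * xb = 0 := by ring
        rw [hzero, map_zero, map_zero]
      rcases mul_eq_zero.1 key with hk | hk
      · exact Or.inl (sub_eq_zero.1 hk)
      · exact Or.inr (sub_eq_zero.1 hk)
    by_cases hA : ∀ x : K, g (φ x) = φ x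
    · left
      ext x
      rw [algEquiv_smul_apply]
      exact hA x
    · right
      push Not at hA
      obtain ⟨a, ha⟩ := hA
      have ha' : g (φ a) = φ (IsCMField.complexConj K a) := (hroot a).resolve_left ha
      ext x
      rw [algEquiv_smul_apply, algEquiv_smul_apply, conjGal_apply_algHom]
      rcases hroot x with hx | hx
      · rcases hroot (a + x) with hax | hax
        · exfalso
          apply ha
          rw [map_add, map_add, hx] at hax
          exact add_right_cancel hax
        · rw [map_add, map_add, map_add, map_add, ha', hx] at hax
          rw [hx]
          exact add_left_cancel hax
      · exact hx
  · rintro (hg | hg) x hx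
    · have := AlgHom.congr_fun hg x
      rwa [algEquiv_smul_apply] at this
    · have := AlgHom.congr_fun hg x
      rw [algEquiv_smul_apply, algEquiv_smul_apply, conjGal_apply_algHom,
        (IsCMField.complexConj_eq_self_iff K x).2 hx] at this
      exact this

omit [IsCMField K] [IsCMField L] in
/-- **`Gal(L/Kᶜ)` is the kernel of the action on the embeddings**: `g` fixes the normal closure
`Kᶜ = normalClosure ℚ K L` (the compositum of the `φ(K)`) pointwise iff `g ∘ φ = φ` for every `φ` ("the action
of `G` on the coset space `H \ G` is effective" exactly when `L = Kᶜ`). [cite: Dodson1984, §1.1 Imprimitivity Theorem (proof)] -/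
theorem mem_fixingSubgroup_normalClosure_iff (g : L ≃ₐ[ℚ] L) :
    g ∈ (normalClosure ℚ K L).fixingSubgroup ↔ ∀ φ : K →ₐ[ℚ] L, g • φ = φ := by
  rw [IntermediateField.mem_fixingSubgroup_iff]
  constructor
  · intro hg φ
    ext x
    rw [algEquiv_smul_apply]
    exact hg _ (AlgHom.fieldRange_le_normalClosure φ ⟨x, rfl⟩)
  · intro hg
    suffices hle : normalClosure ℚ K L ≤ IntermediateField.fixedField (Subgroup.zpowers g) by
      intro y hy
      exact (IntermediateField.mem_fixedField_iff _ y).1 (hle hy) g (Subgroup.mem_zpowers g)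
    rw [normalClosure_le_iff]
    intro φ y hy
    obtain ⟨k, rfl⟩ := AlgHom.mem_fieldRange.1 hy
    rw [IntermediateField.mem_fixedField_iff]
    intro m hm
    obtain ⟨i, rfl⟩ := Subgroup.mem_zpowers_iff.1 hm
    have hfix : φ k ∈ MulAction.fixedBy L g := by
      show g • φ k = φ k
      rw [AlgEquiv.smul_def, ← algEquiv_smul_apply g φ k, hg φ]
    have := MulAction.fixedBy_subset_fixedBy_zpow L g i hfix
    simpa [AlgEquiv.smul_def] using this

/-- **Imprimitivity Theorem (2): `Gal(L/K₀ᶜ)` is the pair kernel.**  For `L/ℚ` normal receiving the CM field `K`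
(`j : K → L`), `g ∈ Gal(L/ℚ)` fixes `K₀ᶜ = normalClosure ℚ K⁺ L` (the Galois closure of the maximal totally real
subfield) pointwise iff `g ∘ φ ∈ {φ, φ̄}` for every embedding `φ : K → L` — "`(ℤ₂)ᵛ = Gal(Kᶜ/K₀ᶜ)` is identified
with the group of permutations preserving the sets of imprimitivity".
[cite: Dodson1984, §1.1 Imprimitivity Theorem (2)] -/
theorem mem_fixingSubgroup_normalClosure_maximalRealSubfield_iff [Normal ℚ L] (j : K →ₐ[ℚ] L)
    (g : L ≃ₐ[ℚ] L) :
    g ∈ (normalClosure ℚ (maximalRealSubfield K) L).fixingSubgroup ↔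
      ∀ φ : K →ₐ[ℚ] L, g • φ = φ ∨ g • φ = (conjGal : L ≃ₐ[ℚ] L) • φ := by
  rw [IntermediateField.mem_fixingSubgroup_iff]
  constructor
  · intro hg φ
    rw [← forall_apply_eq_iff_smul_eq_or]
    intro x hx
    apply hg
    have hmem : φ x ∈ (((φ : K →+* L).comp (maximalRealSubfield K).subtype).toRatAlgHom).fieldRange :=
      ⟨⟨x, hx⟩, rfl⟩
    exact AlgHom.fieldRange_le_normalClosure _ hmem
  · intro hg
    suffices hle : normalClosure ℚ (maximalRealSubfield K) L ≤
        IntermediateField.fixedField (Subgroup.zpowers g) by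
      intro y hy
      exact (IntermediateField.mem_fixedField_iff _ y).1 (hle hy) g (Subgroup.mem_zpowers g)
    rw [normalClosure_le_iff]
    intro f y hy
    obtain ⟨k, rfl⟩ := AlgHom.mem_fieldRange.1 hy
    -- `f` extends to an embedding of `K`: `f = (σ ∘ j)|_{K⁺}` by transitivity of `Gal(L/ℚ)` on `Hom(K⁺, L)`
    obtain ⟨σ, hσ⟩ :=
      exists_algEquiv_smul_eq (((j : K →+* L).comp (maximalRealSubfield K).subtype).toRatAlgHom) f
    have hfk : f k = (σ • j) (k : K) := by
      rw [← hσ]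
      rfl
    have hgfix : g (f k) = f k := by
      rw [hfk]
      exact (forall_apply_eq_iff_smul_eq_or g (σ • j)).2 (hg (σ • j)) k k.2
    rw [IntermediateField.mem_fixedField_iff]
    intro m hm
    obtain ⟨i, rfl⟩ := Subgroup.mem_zpowers_iff.1 hm
    have hfix : f k ∈ MulAction.fixedBy L g := hgfix
    have := MulAction.fixedBy_subset_fixedBy_zpow L g i hfix
    simpa [AlgEquiv.smul_def] using this

/-- `Gal(L/K₀ᶜ) = ⨅_φ Stab{φ, φ̄}` — the pair kernel as an intersection of stabilisers.
[cite: Dodson1984, §1.1 Imprimitivity Theorem (2)] -/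
theorem fixingSubgroup_normalClosure_maximalRealSubfield_eq [Normal ℚ L] (j : K →ₐ[ℚ] L) :
    (normalClosure ℚ (maximalRealSubfield K) L).fixingSubgroup =
      ⨅ φ : K →ₐ[ℚ] L, MulAction.stabilizer (L ≃ₐ[ℚ] L) ({φ, (conjGal : L ≃ₐ[ℚ] L) • φ} : Set (K →ₐ[ℚ] L)) := by
  obtain ⟨ι⟩ : Nonempty (L →+* ℂ) := inferInstance
  have hW := isCMTypeWith_conjGal_algValuedIn ι (CMTypeCount.stdCMType (K := K))
  ext g
  rw [mem_fixingSubgroup_normalClosure_maximalRealSubfield_iff j, hW.mem_iInf_stabilizer_pair_iff]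

/-- **`ρ ∈ Gal(L/K₀ᶜ)`**: complex conjugation fixes the Galois closure of the maximal totally real subfield (which is
totally real). [cite: Dodson1984, §1.1 Proposition] -/
theorem conjGal_mem_fixingSubgroup_normalClosure_maximalRealSubfield [Normal ℚ L] (j : K →ₐ[ℚ] L) :
    (conjGal : L ≃ₐ[ℚ] L) ∈ (normalClosure ℚ (maximalRealSubfield K) L).fixingSubgroup :=
  rho_mem_of_pairKernel (mem_fixingSubgroup_normalClosure_maximalRealSubfield_iff j)

/-- In particular `K₀ᶜ ⊆ L⁺`: every element of the Galois closure of `K⁺` inside `L` is fixed by complex conjugation.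
[cite: Dodson1984, §1.1 Proposition] -/
theorem complexConj_eq_self_of_mem_normalClosure_maximalRealSubfield [Normal ℚ L] (j : K →ₐ[ℚ] L) {y : L}
    (hy : y ∈ normalClosure ℚ (maximalRealSubfield K) L) : IsCMField.complexConj L y = y :=
  (IntermediateField.mem_fixingSubgroup_iff _ _).1
    (conjGal_mem_fixingSubgroup_normalClosure_maximalRealSubfield j) y hy

section NormalClosure

variable [IsNormalClosure ℚ K L]

/-- **§1.1 Proposition: `Gal(Kᶜ/K₀ᶜ)` has exponent `2`** (`L = Kᶜ` a normal closure of `K`, on whose embeddings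
`Gal(L/ℚ)` acts faithfully). [cite: Dodson1984, §1.1 Proposition] -/
theorem mul_self_eq_one_of_mem_fixingSubgroup_normalClosure_maximalRealSubfield (j : K →ₐ[ℚ] L)
    {g : L ≃ₐ[ℚ] L} (hg : g ∈ (normalClosure ℚ (maximalRealSubfield K) L).fixingSubgroup) : g * g = 1 := by
  haveI : Normal ℚ L := IsNormalClosure.normal (F := ℚ) (K := K) (L := L)
  obtain ⟨ι⟩ : Nonempty (L →+* ℂ) := inferInstance
  exact (isCMTypeWith_conjGal_algValuedIn ι (CMTypeCount.stdCMType (K := K))).mul_self_eq_one_of_mem_pairKernel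
    (mem_fixingSubgroup_normalClosure_maximalRealSubfield_iff j) hg

/-- **§1.1 Proposition: `Gal(Kᶜ/K₀ᶜ)` is commutative** (an elementary abelian `2`-group `(ℤ₂)ᵛ`).
[cite: Dodson1984, §1.1 Proposition] -/
theorem mul_comm_of_mem_fixingSubgroup_normalClosure_maximalRealSubfield (j : K →ₐ[ℚ] L)
    {a b : L ≃ₐ[ℚ] L} (ha : a ∈ (normalClosure ℚ (maximalRealSubfield K) L).fixingSubgroup)
    (hb : b ∈ (normalClosure ℚ (maximalRealSubfield K) L).fixingSubgroup) : a * b = b * a := by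
  haveI : Normal ℚ L := IsNormalClosure.normal (F := ℚ) (K := K) (L := L)
  obtain ⟨ι⟩ : Nonempty (L →+* ℂ) := inferInstance
  exact (isCMTypeWith_conjGal_algValuedIn ι (CMTypeCount.stdCMType (K := K))).mul_comm_of_mem_pairKernel
    (mem_fixingSubgroup_normalClosure_maximalRealSubfield_iff j) ha hb

/-- **§1.1 Proposition: `[Kᶜ : K₀ᶜ] = 2ᵛ` with `1 ≤ v ≤ n`**, `2n = [K : ℚ]`, for a normal closure `L = Kᶜ` of the
CM field `K`. [cite: Dodson1984, §1.1 Proposition] -/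
theorem exists_finrank_normalClosure_maximalRealSubfield_eq_two_pow (j : K →ₐ[ℚ] L) :
    ∃ v : ℕ, 1 ≤ v ∧ v ≤ Module.finrank ℚ K / 2 ∧
      Module.finrank (normalClosure ℚ (maximalRealSubfield K) L) L = 2 ^ v := by
  haveI : Normal ℚ L := IsNormalClosure.normal (F := ℚ) (K := K) (L := L)
  haveI : IsGalois ℚ L := isGalois_of_isNormalClosure (L := L) K
  obtain ⟨ι⟩ : Nonempty (L →+* ℂ) := inferInstance
  haveI : Nonempty (K →ₐ[ℚ] L) := ⟨j⟩
  obtain ⟨v, hv1, hvn, hv⟩ := (isCMTypeWith_conjGal_algValuedIn ι (CMTypeCount.stdCMType (K := K))).exists_card_pairKernel_eq_two_pow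
    (mem_fixingSubgroup_normalClosure_maximalRealSubfield_iff j)
  refine ⟨v, hv1, ?_, ?_⟩
  · rwa [Nat.card_eq_fintype_card, card_algHom_eq_finrank K] at hvn
  · rw [← IsGalois.card_fixingSubgroup_eq_finrank, hv]

/-- **The Reflex Degree Theorem, field form: `Kᶜ = K′ · K₀ᶜ`.**  In a normal closure `L = Kᶜ` of the CM field `K`,
the reflex field `K′` of ANY CM type of `K` and the Galois closure `K₀ᶜ` of the maximal totally real subfield
generate `L` (`Gal(L/K′) ∩ Gal(L/K₀ᶜ) = H′(Φ) ∩ (ℤ₂)ᵛ = 1`). [cite: Dodson1984, §1.3 Reflex Degree Theorem] -/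
theorem reflexField_sup_normalClosure_maximalRealSubfield_eq_top (j : K →ₐ[ℚ] L) {Ψ : Set (K →ₐ[ℚ] L)}
    (hΨ : IsCMTypeWith (conjGal : L ≃ₐ[ℚ] L) Ψ) :
    reflexField ℚ L Ψ ⊔ normalClosure ℚ (maximalRealSubfield K) L = ⊤ := by
  haveI : Normal ℚ L := IsNormalClosure.normal (F := ℚ) (K := K) (L := L)
  haveI : IsGalois ℚ L := isGalois_of_isNormalClosure (L := L) K
  have hbot : (reflexField ℚ L Ψ ⊔ normalClosure ℚ (maximalRealSubfield K) L).fixingSubgroup = ⊥ := by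
    rw [IntermediateField.fixingSubgroup_sup, reflexField_eq_fixedField, IntermediateField.fixingSubgroup_fixedField]
    exact hΨ.stabilizer_inf_pairKernel_eq_bot (mem_fixingSubgroup_normalClosure_maximalRealSubfield_iff j)
  have key := congrArg IntermediateField.fixedField hbot
  rwa [IsGalois.fixedField_fixingSubgroup, IntermediateField.fixedField_bot] at key

/-- In a finite Galois extension, `Gal(L/(M₁ ∩ M₂)) = Gal(L/M₁) ⊔ Gal(L/M₂)`. [folklore] -/
private theorem fixingSubgroup_inf_eq_sup {Ω : Type} [Field Ω] [NumberField Ω] [IsGalois ℚ Ω]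
    (M₁ M₂ : IntermediateField ℚ Ω) : (M₁ ⊓ M₂).fixingSubgroup = M₁.fixingSubgroup ⊔ M₂.fixingSubgroup := by
  have e := (IsGalois.intermediateFieldEquivSubgroup (F := ℚ) (E := Ω)).map_inf M₁ M₂
  exact congrArg OrderDual.ofDual e

/-- **The Reflex Degree Theorem: `[K′ : ℚ] = [Kᶜ : K₀ᶜ] · [K′ ∩ K₀ᶜ : ℚ]`** — Dodson's `[K′ : ℚ] = 2ᵛ (G₀ : S₀)`:
`2ᵛ = [Kᶜ : K₀ᶜ]`, and the splitting subgroup `S₀`, the image of `H′(Φ) = Gal(Kᶜ/K′)` in `G₀ = Gal(K₀ᶜ/ℚ)`, is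
`Gal(K₀ᶜ / K′ ∩ K₀ᶜ)`, of index `[K′ ∩ K₀ᶜ : ℚ]`. [cite: Dodson1984, §1.3 Reflex Degree Theorem] -/
theorem finrank_reflexField_eq_finrank_mul_finrank_inf (j : K →ₐ[ℚ] L) {Ψ : Set (K →ₐ[ℚ] L)}
    (hΨ : IsCMTypeWith (conjGal : L ≃ₐ[ℚ] L) Ψ) :
    Module.finrank ℚ (reflexField ℚ L Ψ) =
      Module.finrank (normalClosure ℚ (maximalRealSubfield K) L) L *
        Module.finrank ℚ ↥(reflexField ℚ L Ψ ⊓ normalClosure ℚ (maximalRealSubfield K) L) := by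
  haveI : Normal ℚ L := IsNormalClosure.normal (F := ℚ) (K := K) (L := L)
  haveI : IsGalois ℚ L := isGalois_of_isNormalClosure (L := L) K
  have hV := mem_fixingSubgroup_normalClosure_maximalRealSubfield_iff (K := K) (L := L) j
  have key := hΨ.index_stabilizer_eq_card_pairKernel_mul hV
  have hstab : MulAction.stabilizer (L ≃ₐ[ℚ] L) Ψ = (reflexField ℚ L Ψ).fixingSubgroup := by
    rw [reflexField_eq_fixedField, IntermediateField.fixingSubgroup_fixedField]
  rw [hstab, ← fixingSubgroup_inf_eq_sup, index_fixingSubgroup_eq_finrank, index_fixingSubgroup_eq_finrank,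
    IsGalois.card_fixingSubgroup_eq_finrank] at key
  exact key

/-- **`2ᵛ = [Kᶜ : K₀ᶜ]` divides `[K′ : ℚ]`** for every CM type. [cite: Dodson1984, §1.3 Reflex Degree Theorem] -/
theorem finrank_normalClosure_maximalRealSubfield_dvd_finrank_reflexField (j : K →ₐ[ℚ] L)
    {Ψ : Set (K →ₐ[ℚ] L)} (hΨ : IsCMTypeWith (conjGal : L ≃ₐ[ℚ] L) Ψ) :
    Module.finrank (normalClosure ℚ (maximalRealSubfield K) L) L ∣ Module.finrank ℚ (reflexField ℚ L Ψ) :=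
  Dvd.intro _ (finrank_reflexField_eq_finrank_mul_finrank_inf j hΨ).symm

/-- Hence `[K′ : ℚ] ≥ [Kᶜ : K₀ᶜ] = 2ᵛ`. [cite: Dodson1984, §1.3 Reflex Degree Theorem] -/
theorem finrank_normalClosure_maximalRealSubfield_le_finrank_reflexField (j : K →ₐ[ℚ] L)
    {Ψ : Set (K →ₐ[ℚ] L)} (hΨ : IsCMTypeWith (conjGal : L ≃ₐ[ℚ] L) Ψ) :
    Module.finrank (normalClosure ℚ (maximalRealSubfield K) L) L ≤ Module.finrank ℚ (reflexField ℚ L Ψ) :=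
  Nat.le_of_dvd Module.finrank_pos (finrank_normalClosure_maximalRealSubfield_dvd_finrank_reflexField j hΨ)

/-- **`H′(Φ) ≅ S₀`**: the projection `G → G₀ = G/Gal(L/K₀ᶜ)` (`≅ Gal(K₀ᶜ/ℚ)`, Mathlib
`IsGalois.normalAutEquivQuotient`) is injective on the stabiliser `H′(Φ) = Gal(L/K′)` of a CM type.
[cite: Dodson1984, §1.3 Reflex Degree Theorem (proof)] -/
theorem injOn_quotientMk_stabilizer_fixingSubgroup (j : K →ₐ[ℚ] L) {Ψ : Set (K →ₐ[ℚ] L)}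
    (hΨ : IsCMTypeWith (conjGal : L ≃ₐ[ℚ] L) Ψ) :
    Set.InjOn (QuotientGroup.mk : (L ≃ₐ[ℚ] L) → (L ≃ₐ[ℚ] L) ⧸ (normalClosure ℚ (maximalRealSubfield K) L).fixingSubgroup)
      (MulAction.stabilizer (L ≃ₐ[ℚ] L) Ψ) := by
  haveI : Normal ℚ L := IsNormalClosure.normal (F := ℚ) (K := K) (L := L)
  exact hΨ.injOn_quotientMk_stabilizer (mem_fixingSubgroup_normalClosure_maximalRealSubfield_iff j)

/-- **§2.1.2 Corollary: `[K′ : ℚ] = 2ᵛ = [Kᶜ : K₀ᶜ]` iff `K′ ∩ K₀ᶜ = ℚ`** (iff the splitting subgroup is all of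
`G₀`). [cite: Dodson1984, §2.1.2 Corollary] -/
theorem finrank_reflexField_eq_iff_inf_eq_bot (j : K →ₐ[ℚ] L) {Ψ : Set (K →ₐ[ℚ] L)}
    (hΨ : IsCMTypeWith (conjGal : L ≃ₐ[ℚ] L) Ψ) :
    Module.finrank ℚ (reflexField ℚ L Ψ) = Module.finrank (normalClosure ℚ (maximalRealSubfield K) L) L ↔
      reflexField ℚ L Ψ ⊓ normalClosure ℚ (maximalRealSubfield K) L = ⊥ := by
  rw [finrank_reflexField_eq_finrank_mul_finrank_inf j hΨ, ← IntermediateField.finrank_eq_one_iff]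
  have hpos : 0 < Module.finrank (normalClosure ℚ (maximalRealSubfield K) L) L := Module.finrank_pos
  constructor
  · intro h
    apply Nat.eq_of_mul_eq_mul_left hpos
    rw [mul_one]
    exact h
  · intro h
    rw [h, mul_one]

/-- **§2.1.2 Corollary, splitting form**: `[K′ : ℚ] = [Kᶜ : K₀ᶜ]` iff `Gal(Kᶜ/K′)` is a complement of
`Gal(Kᶜ/K₀ᶜ) = (ℤ₂)ᵛ` in `Gal(Kᶜ/ℚ)` — "`Gal(Kᶜ/K′) ≅ Gal(K₀ᶜ/ℚ)` gives a splitting of the imprimitivity sequence of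
`Gal(Kᶜ/ℚ)`". [cite: Dodson1984, §2.1.2 Corollary] -/
theorem finrank_reflexField_eq_iff_isComplement' (j : K →ₐ[ℚ] L) {Ψ : Set (K →ₐ[ℚ] L)}
    (hΨ : IsCMTypeWith (conjGal : L ≃ₐ[ℚ] L) Ψ) :
    Module.finrank ℚ (reflexField ℚ L Ψ) = Module.finrank (normalClosure ℚ (maximalRealSubfield K) L) L ↔
      (reflexField ℚ L Ψ).fixingSubgroup.IsComplement'
        (normalClosure ℚ (maximalRealSubfield K) L).fixingSubgroup := by
  haveI : Normal ℚ L := IsNormalClosure.normal (F := ℚ) (K := K) (L := L)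
  haveI : IsGalois ℚ L := isGalois_of_isNormalClosure (L := L) K
  have hV := mem_fixingSubgroup_normalClosure_maximalRealSubfield_iff (K := K) (L := L) j
  have hstab : (reflexField ℚ L Ψ).fixingSubgroup = MulAction.stabilizer (L ≃ₐ[ℚ] L) Ψ := by
    rw [reflexField_eq_fixedField, IntermediateField.fixingSubgroup_fixedField]
  rw [hstab, hΨ.isComplement'_stabilizer_pairKernel_iff hV, finrank_reflexField_eq_card_orbit,
    IsGalois.card_fixingSubgroup_eq_finrank]

end NormalClosure

/-- **The Reflex Degree Theorem in ANY Galois CM field `L ⊇ K`: `K′ · K₀ᶜ = Kᶜ`** — the reflex field of a CM type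
and the Galois closure of `K⁺` generate the Galois closure of `K` (`Gal(L/K′) ∩ Gal(L/K₀ᶜ)` acts trivially on the
embeddings, i.e. fixes `Kᶜ`). [cite: Dodson1984, §1.3 Reflex Degree Theorem] -/
theorem reflexField_sup_normalClosure_maximalRealSubfield_eq_normalClosure [IsGalois ℚ L] (j : K →ₐ[ℚ] L)
    {Ψ : Set (K →ₐ[ℚ] L)} (hΨ : IsCMTypeWith (conjGal : L ≃ₐ[ℚ] L) Ψ) :
    reflexField ℚ L Ψ ⊔ normalClosure ℚ (maximalRealSubfield K) L = normalClosure ℚ K L := by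
  have hV := mem_fixingSubgroup_normalClosure_maximalRealSubfield_iff (K := K) (L := L) j
  have hsub : (reflexField ℚ L Ψ ⊔ normalClosure ℚ (maximalRealSubfield K) L).fixingSubgroup =
      (normalClosure ℚ K L).fixingSubgroup := by
    rw [IntermediateField.fixingSubgroup_sup, reflexField_eq_fixedField, IntermediateField.fixingSubgroup_fixedField]
    ext g
    rw [Subgroup.mem_inf, mem_fixingSubgroup_normalClosure_iff (K := K)]
    constructor
    · rintro ⟨hg, hgV⟩ φ
      ext x
      rw [algEquiv_smul_apply]
      have := hΨ.smul_eq_self_of_mem_stabilizer_of_mem_pairKernel hV hg hgV φ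
      exact AlgHom.congr_fun this x
    · intro hg
      refine ⟨?_, (hV g).2 fun φ => Or.inl (hg φ)⟩
      rw [MulAction.mem_stabilizer_iff]
      ext φ
      constructor
      · rintro ⟨ψ, hψ, rfl⟩
        change g • ψ ∈ Ψ
        rwa [hg ψ]
      · intro hφ
        exact ⟨φ, hφ, hg φ⟩
  have key := congrArg IntermediateField.fixedField hsub
  rwa [IsGalois.fixedField_fixingSubgroup, IsGalois.fixedField_fixingSubgroup] at key

/-- The same for the tree's complex CM types `Φ : CMType K` read in `L` through `ι : L → ℂ`: `K′(Φ) · K₀ᶜ = Kᶜ`.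
[cite: Dodson1984, §1.3 Reflex Degree Theorem] -/
theorem reflexField_algValuedIn_sup_normalClosure_maximalRealSubfield [IsGalois ℚ L] (j : K →ₐ[ℚ] L)
    (ι : L →+* ℂ) (Φ : CMType K) :
    reflexField ℚ L (algValuedIn ι Φ.1) ⊔ normalClosure ℚ (maximalRealSubfield K) L = normalClosure ℚ K L :=
  reflexField_sup_normalClosure_maximalRealSubfield_eq_normalClosure j (isCMTypeWith_conjGal_algValuedIn ι Φ)

/-- … and in a normal closure: `[Kᶜ : K₀ᶜ] ∣ [K′(Φ) : ℚ]` for every complex CM type `Φ` of `K`.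
[cite: Dodson1984, §1.3 Reflex Degree Theorem] -/
theorem finrank_normalClosure_maximalRealSubfield_dvd_finrank_reflexField_algValuedIn [IsNormalClosure ℚ K L]
    (j : K →ₐ[ℚ] L) (ι : L →+* ℂ) (Φ : CMType K) :
    Module.finrank (normalClosure ℚ (maximalRealSubfield K) L) L ∣
      Module.finrank ℚ (reflexField ℚ L (algValuedIn ι Φ.1)) :=
  finrank_normalClosure_maximalRealSubfield_dvd_finrank_reflexField j (isCMTypeWith_conjGal_algValuedIn ι Φ)

end NumberField

end Literature.NumberTheory.ComplexMultiplication
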